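import Summits.BirchSwinnertonDyer.BirchSwinnertonDyer.Theorems.TwoAdicConverseLambdaHalfDefs
import Summits.BirchSwinnertonDyer.Rank1Residual.F1Sign2.AnalyticLineTransferAtTwo
import HarnessLib

/-!
# Sketch (crux-ideate r1, ideator 1, GEN 3) — idea `elliptic-shadow-two` for crux `OrdLambdaHalfAtTwo`
# (item stmt-BirchSwinnertonDyer-19556, route TwoAdicConverse, rung S3)

Typed FIRST LEMMA of the line «weight-one dihedral shadow + elliptic units at a prime NOT split in the
resolvent field»: on the RIGID LOCUS `𝔖⁻ = {Δ_E < 0, Δ_E ∉ (ℚ₂ˣ)², no rational 2-torsion}` the `λ`-half of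
the `2`-adic main conjecture follows from two statements about ONE number `Φ(K)` attached to the cubic
`2`-division field `K = ℚ(E[2]-root)` (equivalently to the weight-one theta series `θ_χ` of
`F = ℚ(√Δ_E)`, `χ` the cubic ring-class character cutting out the Galois closure `M = K(√Δ_E)`):
(SH-an) the analytic identity `λ(L₂(E)) + Σ_{ℓ∣N} e_ℓ(E) = Φ(K) + Σ_{ℓ∣N} e_ℓ(Ind χ)` and (SH-alg) the
algebraic inequality `Φ(K) + Σ e_ℓ(Ind χ) ≤ λ(X(E/ℚ_∞)) + Σ e_ℓ(E)`.  The Artin local terms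
`e_ℓ(Ind_K^ℚ 𝟙 ⊖ 𝟙) = 2^{n_ℓ} · (Σ_{𝔩 ∣ ℓ} 2^{v₂ f(𝔩∣ℓ)} − 1)` are DEFINED here from the splitting of `ℓ`
in `K` (no curve in them).  Nothing is asserted: `Φ` is a parameter; the two `Prop`s are hypotheses of
the proved reduction `lambdaHalfAtTwo_of_shadow`.  BSD is not proved by any of this.
-/

set_option linter.dupNamespace false
set_option autoImplicit false

noncomputable section

open scoped Classical MatrixGroups ModularForm
open CongruenceSubgroup Polynomial WeierstrassCurve
open Literature.NumberTheory.EllipticCurves Literature.NumberTheory.EllipticCurves.ModularForms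
open Literature.NumberTheory.EllipticCurves.Greenberg1999
open Literature.NumberTheory.EllipticCurves.Rank1Residual
open Summit.BirchSwinnertonDyer.Rank1Residual.X1.MuLambda
open Summit.BirchSwinnertonDyer.Rank1Residual.F1Sign2
open Summit.BirchSwinnertonDyer.BirchSwinnertonDyer.Theorems.TwoAdicTwistConverse
open IsDedekindDomain NumberField

namespace Summit.BirchSwinnertonDyer.BirchSwinnertonDyer.Cruxes.OrdLambdaHalfAtTwo.EllipticShadowTwo

/-- The RIGID LOCUS `𝔖⁻` at `2`: `Δ < 0` (complex conjugation acts on `E[2]` as a transposition),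
`Δ` is not a square in `ℚ₂` (for a curve good ordinary at `2`: `E[2] ⊄ E(ℚ₂)`, i.e. the decomposition
group at `2` acts non-trivially on `E[2]`; equivalently `2` does not split in `ℚ(√Δ)`; equivalently OFF
the Kilford stratum), and no rational `2`-torsion (so, `Δ` being a non-square, `ρ̄_{E,2}` has image `S₃`). -/
def OnRigidLocusAtTwo (W : WeierstrassCurve ℚ) : Prop :=
  W.Δ < 0 ∧ ¬ IsSquare ((W.Δ : ℚ) : ℚ_[2]) ∧ ∀ x : ℚ, ¬ HasRationalTwoTorsionX W x

/-- The ARTIN local `λ`-correction at an odd prime `ℓ` of the `2`-dimensional representation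
`ρ_K = Ind_K^ℚ 𝟙 ⊖ 𝟙` of a cubic field `K` (for `K = ℚ(E[2]-root)` with image `S₃`: `ρ_K ≅ Ind_F^ℚ χ`,
the weight-one dihedral shadow of `E`), p = 2: `e_ℓ(ρ_K) = 2^{n_ℓ} · ((Σ_{𝔩 ∣ ℓ} 2^{v₂ f(𝔩∣ℓ)}) − 1)` —
the number of Frobenius eigenvalues `≡ 1 (mod 𝔪)` on the inertia invariants `(Ind_K^ℚ 𝟙)^{I_ℓ} = ⊕_{𝔩∣ℓ}
Ind(unramified quotient)`, minus the one of `𝟙`, times the number `2^{n_ℓ}` of primes of `ℚ_∞` over `ℓ`.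
Values: `2·2^{n_ℓ}` if `ℓ` is unramified with Frobenius of order `≤ 2`, `0` if Frobenius is a `3`-cycle,
`2^{n_ℓ}` if `ℓ = 𝔩₁𝔩₂²`, `0` if `ℓ = 𝔩³`.  At a prime of good reduction of `E` it equals
`lambdaCorrectionAtTwo W ℓ` (parity of `a_ℓ` ↔ `ℓ` has a degree-one prime in `K`). -/
def shadowCorrectionAtTwo (K : Type) [Field K] [NumberField K] (ℓ : ℕ) : ℕ :=
  2 ^ matsunoIndex ℓ *
    ((∑ P ∈ IsDedekindDomain.primesOverFinset (Ideal.span {(ℓ : ℤ)}) (𝓞 K), 2 ^ padicValNat 2 (P.inertiaDeg ℤ)) - 1)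

/-- **(SH-an) analytic shadow identity on `𝔖⁻`** for a candidate shadow invariant `Φ` (a function of the
cubic `2`-division field; conjecturally `Φ(K) = λ` of the cyclotomic `2`-adic `L`-function of the weight-one
form `θ_χ`, = `λ` of the `ε`-projected Coleman series of the elliptic units of `M/F`): for every good ordinary
`W` on the rigid locus with `2`-division field `K ∋ e`, SOME nonzero integral rational multiple `L₀` of
`L₂(f_E, α)` has `λ(L₀) + Σ_{ℓ ∣ N, ℓ odd} e_ℓ(E) = Φ(K) + Σ_{ℓ ∣ N, ℓ odd} e_ℓ(ρ_K)`.  Hypothesis shape;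
nothing asserted. -/
def ShadowAnalyticIdentityAtTwo (Φ : ∀ (K : Type) [Field K] [NumberField K], ℕ) : Prop :=
  ∀ (W : WeierstrassCurve ℚ) [W.IsElliptic] [W.IsGloballyMinimal], OnRigidLocusAtTwo W → IsOrdinaryAt W 2 →
    ∀ (K : Type) [Field K] [NumberField K], Module.finrank ℚ K = 3 →
    ∀ e : K, aeval e (twoDivisionUCubic W) = 0 →
    ∀ [NeZero (W.conductorNorm ℤ)] (f : CuspForm (Gamma0 (W.conductorNorm ℤ)) 2), IsNewformOf W f →
      ∃ (c : ℚ) (L₀ : IwasawaAlgebra 2), L₀ ≠ 0 ∧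
        iwasawaToPowerSeries 2 L₀ = PowerSeries.C (c : ℚ_[2]) * padicLFunction f (unitRoot W 2 : ℚ_[2]) ∧
        lam L₀ + ∑ ℓ ∈ (W.conductorNorm ℤ).primeFactors.erase 2, lambdaCorrectionAtTwo W ℓ =
          Φ K + ∑ ℓ ∈ (W.conductorNorm ℤ).primeFactors.erase 2, shadowCorrectionAtTwo K ℓ

/-- **(SH-alg) algebraic shadow bound on `𝔖⁻`** (the half the crux needs; the mechanism predicts equality:
Matsuno 2008 Thm 4.2 transport + the Greenberg–Vatsal four-term sequence for `ρ_K` at `p = 2` via the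
odd-index Shapiro isomorphism `H¹(ℚ_∞, E[2]) ⊕ H¹(ℚ_∞, 𝔽₂) = H¹(Kℚ_∞, 𝔽₂)` + Johnson-Leung–Kings 2011 §5.4
`char A_∞^χ = char (ℰ_∞/𝒞_∞)^χ` for ALL `p ∤ #Gal(M/F) = 3`): `Φ(K) + Σ e_ℓ(ρ_K) ≤ λ(X(E/ℚ_∞)) + Σ e_ℓ(E)`
for every dual datum of `X(E/ℚ_∞)` at the cyclotomic data.  Hypothesis shape; nothing asserted. -/
def ShadowAlgebraicBoundAtTwo (Φ : ∀ (K : Type) [Field K] [NumberField K], ℕ) : Prop :=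
  ∀ (W : WeierstrassCurve ℚ) [W.IsElliptic] [W.IsGloballyMinimal], OnRigidLocusAtTwo W → IsOrdinaryAt W 2 →
    ∀ (K : Type) [Field K] [NumberField K], Module.finrank ℚ K = 3 →
    ∀ e : K, aeval e (twoDivisionUCubic W) = 0 →
    ∀ (κ : ZpExtension ℚ 2) (γ : Field.absoluteGaloisGroup ℚ),
      κ.IsCyclotomic → κ.IsTopGenerator γ → IsCyclotomicVariable 2 γ →
    ∀ (D : W.SelmerDualData κ γ),
      Φ K + ∑ ℓ ∈ (W.conductorNorm ℤ).primeFactors.erase 2, shadowCorrectionAtTwo K ℓ ≤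
        D.lambda + ∑ ℓ ∈ (W.conductorNorm ℤ).primeFactors.erase 2, lambdaCorrectionAtTwo W ℓ

/-- **First lemma (proved): the shadow pincer closes the crux on the rigid locus.**  For any candidate
shadow invariant `Φ`, (SH-an) and (SH-alg) give `LambdaHalfAtTwo W` for every `W ∈ 𝔖⁻` whose `2`-division
cubic has a root in a cubic number field `K` (always the case on `𝔖⁻`: the cubic is irreducible). -/
theorem lambdaHalfAtTwo_of_shadow (Φ : ∀ (K : Type) [Field K] [NumberField K], ℕ)
    (han : ShadowAnalyticIdentityAtTwo Φ) (halg : ShadowAlgebraicBoundAtTwo Φ)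
    (W : WeierstrassCurve ℚ) [W.IsElliptic] [W.IsGloballyMinimal] (hW : OnRigidLocusAtTwo W)
    (K : Type) [Field K] [NumberField K] (hK : Module.finrank ℚ K = 3)
    (e : K) (he : aeval e (twoDivisionUCubic W) = 0) :
    LambdaHalfAtTwo W := by
  intro κ γ hκ hγ hvar hord _ f hf D
  obtain ⟨c, L₀, hL₀, hι, hsum⟩ := han W hW hord K hK e he f hf
  have hle := halg W hW hord K hK e he κ γ hκ hγ hvar D
  exact ⟨c, L₀, hL₀, hι, by omega⟩

/-- **Composition with the complement.** If the off-locus curves (`Δ > 0`, or `Δ ∈ (ℚ₂ˣ)²` = Kilford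
stratum, or rational `2`-torsion — the habitats of the other cards) are handled separately, the shadow
pincer on `𝔖⁻` yields the crux `OrdLambdaHalfAtTwo`.  The cubic-field witness is supplied as a hypothesis
(`K = ℚ[X]/(u-cubic)`, a field since a cubic without rational root is irreducible). -/
theorem ordLambdaHalfAtTwo_of_shadow (Φ : ∀ (K : Type) [Field K] [NumberField K], ℕ)
    (han : ShadowAnalyticIdentityAtTwo Φ) (halg : ShadowAlgebraicBoundAtTwo Φ)
    (hoff : ∀ (W : WeierstrassCurve ℚ) [W.IsElliptic] [W.IsGloballyMinimal],
      ¬ W.HasCM → GoodOrd W 2 → ¬ OnRigidLocusAtTwo W → LambdaHalfAtTwo W)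
    (hfield : ∀ (W : WeierstrassCurve ℚ) [W.IsElliptic] [W.IsGloballyMinimal], OnRigidLocusAtTwo W →
      ∃ (K : Type) (_ : Field K) (_ : NumberField K), Module.finrank ℚ K = 3 ∧
        ∃ e : K, aeval e (twoDivisionUCubic W) = 0) :
    OrdLambdaHalfAtTwo := by
  intro W _ _ hCM hgood
  by_cases hW : OnRigidLocusAtTwo W
  · obtain ⟨K, iF, iN, hK, e, he⟩ := hfield W hW
    exact lambdaHalfAtTwo_of_shadow Φ han halg W hW K hK e he
  · exact hoff W hCM hgood hW

end Summit.BirchSwinnertonDyer.BirchSwinnertonDyer.Cruxes.OrdLambdaHalfAtTwo.EllipticShadowTwo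

end
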